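import Mathlib.Algebra.BigOperators.Group.Finset.Basic
import Mathlib.Algebra.BigOperators.Ring.Finset
import Mathlib.Algebra.BigOperators.Intervals
import Mathlib.Algebra.BigOperators.GroupWithZero.Action
import Mathlib.Algebra.Module.BigOperators
import Mathlib.Algebra.Module.Basic
import Mathlib.Tactic.Ring
import Mathlib.Tactic.Abel
import Mathlib.Tactic.Module
import HarnessLib

/-!
# Route `ByReductionTypeAtTwo`, crux `RankOneAtTwoOffBigImageOddLocal` (stmt-BirchSwinnertonDyer-23716), line
# `refined_kolyvagin_tamagawa_shift_at_two`, stub `stub_sigmaShiftPosDisc`: THE NORM OF THE KOLYVAGIN DERIVATIVE AT A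
# COMPLEX CONJUGATION — the dihedral identity `(1 + τ) D_ℓ y_ℓ = −(ℓ+1) Σ_{j ≤ k₀} σ^j y_ℓ + (ℓ+1+k₀) Tr_ℓ y_ℓ` and the
# EXPLICIT `2^M`-th root of `P_ℓ + τ P_ℓ` (pure algebra, PROVED)

Lead prover `prover-cruxlead-stmt-BirchSwinnertonDyer-23716-g11` (2026-08-29), `--supports stmt-BirchSwinnertonDyer-23716`
(helper; closes nothing).  THEOREMS ONLY (no definition, no named fact, no `sorry`).  Companion memo
`Cruxes/RankOneAtTwoOffBigImageOddLocal/ArchBoundaryBitAtTwo.md` (crux-dir commit 3c8c486a5bcb).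

WHY.  On `{Δ > 0}` the real place of `ℚ` carries a non-vacuous level-`2^M` Selmer condition for the `ℚ`-descended
Kolyvagin classes `d_M(ℓ) ∈ H¹(ℚ, E^K[2^M])` (lead memos g4/g5; `H¹(ℝ, E^K) ≅ π₀(E(ℝ)) = ℤ/2`).  One level below the
capacity of the prime the condition is free (`H¹(ℝ, ·)` is `2`-torsion; tree `torsionH1ZSMul_two_kolyvaginClass`,
`torsionH1ZSMul_two_mem_selmerLocalKer_infinitePlace_of_resTorsion_mem`).  AT BOUNDARY LEVEL `M = M(ℓ)` the Selmer bit is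
`[R ∉ E(ℝ)⁰]` for the unique `R ∈ E(K_ℓ)` with `2^M R = P_ℓ + τ P_ℓ` (memo §1; seat `bsd-2adic-kit-3`'s table, 8 rows).
This file computes `P_ℓ + τ P_ℓ` EXACTLY from the three relations that govern the Heegner module — `σ^{ℓ+1} = 1`,
`τ σ = σ⁻¹ τ`, `τ y_ℓ = σ^{k₀} y_ℓ` (Gross 1991 Prop. 5.3 with `Φ(0) = 0`, as `L(E,1) = 0`) — and exhibits the root:

* §1 ring identities in the commutative group ring `ℤ[G_ℓ]` (`σ ∈ R`, `σ^m = 1`, `D = Σ_{i<m} i σ^i`, `Tr = Σ_{i<m} σ^i`; same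
  currency as the tree's `Literature…KolyvaginDerivative.sub_one_mul_kolyvaginDerivative` = Gross (3.5), which this file re-derives
  in the form `σ D = D + (m − Tr)` from two `σ^m`-free shift identities so as to import Mathlib only): `σ^k Tr = Tr`,
  `σ^k D = D + (Σ_{j<k} σ^j)(m − Tr)`,
  `(Σ_{j<k} σ^j) Tr = k Tr`, and the REFLECTION `Σ_{i<m} i σ′^i = m (Tr − 1) − D` for `σ σ′ = 1` (`σ′ = σ⁻¹`);
* §2 THE DIHEDRAL IDENTITY `norm_kolyvaginDerivative_smul`: for an additive `τ` on the module with `τ (σ • x) = σ′ • τ x`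
  and `τ y = σ^{k₀} • y`:  `D•y + τ (D•y) = −(m • Σ_{j ≤ k₀} σ^j • y) + (m + k₀) • Tr • y`;
* §3 THE PAIRING `Σ_{j ≤ k₀} σ^j y = (Y + τ Y) + [k₀ even] σ^{k₀/2} y` (`τ` reverses the interval `[0, k₀]`), whence the
  explicit root: `D•y + τ(D•y) = −m•(Y + τ Y) − [k₀ even] m • σ^{k₀/2} • y + (m+k₀) • Tr • y`, the middle term `τ`-FIXED;
  with `m = 2^e u` and `Tr • y = 2^e • t` the right side is `2^e •` an explicit point (`…_eq_two_pow_smul_of_even/odd`).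

Consequence (memo §2–§3, not formalised here): in `Ĥ⁰(⟨τ⟩, E(K_ℓ))` the class of the root is `[u odd][k₀ even]·[σ^{k₀/2} y_ℓ]
+ [v odd][k₀ odd]·[y_K]` (`h_K = 1`), `k₀ even ⟺ (N/ℓ) = +1`; so the boundary-level archimedean Selmer bit of `d_M(ℓ)` is
the real component of ONE τ-real Heegner value, and vanishes outright when `(N/ℓ) = −1` and `M₀ ≥ 1`.
BSD is NOT proved by any of this; the crux is NOT proved; the stub is NOT proved.

References: [GrossLMS1991] B. H. Gross, *Kolyvagin's work on modular elliptic curves*, LMS LNS 153 (1991), §3 (3.5),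
Prop. 3.6, Prop. 5.3 (held `book:editornd-l-functions-arithmetic`); [McCallumLMS1991] W. G. McCallum, *Kolyvagin's work on
Shafarevich–Tate groups*, ibid., §4 (the cocycle of `c_M(n)`), §5; [Rubin2000] K. Rubin, *Euler Systems*, IV §4.
-/

set_option linter.dupNamespace false -- tree convention: `Summit.BirchSwinnertonDyer.BirchSwinnertonDyer.Theorems` (summit = sub-problem)
set_option autoImplicit false

open Finset

namespace Summit.BirchSwinnertonDyer.BirchSwinnertonDyer.Theorems.OffBigImageOddLocalAtTwo.ArchBoundaryNorm


/-! ## §1 Ring identities in the commutative group ring -/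

section Ring

variable {R : Type*} [CommRing R]

/-- `σ · Tr = Tr` for `Tr = Σ_{i<m} σ^i` when `σ^m = 1`. [cite: GrossLMS1991, §3 (3.5)] -/
theorem mul_trace_eq {σ : R} {m : ℕ} (hσ : σ ^ m = 1) :
    σ * ∑ i ∈ range m, σ ^ i = ∑ i ∈ range m, σ ^ i := by
  rw [mul_sum]
  simp_rw [← pow_succ']
  cases m with
  | zero => simp
  | succ m => rw [sum_range_succ, sum_range_succ' (fun i ↦ σ ^ i), hσ, pow_zero]

/-- `σ^k · Tr = Tr` when `σ^m = 1`. [cite: GrossLMS1991, §3 (3.5)] -/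
theorem pow_mul_trace_eq {σ : R} {m : ℕ} (hσ : σ ^ m = 1) (k : ℕ) :
    σ ^ k * ∑ i ∈ range m, σ ^ i = ∑ i ∈ range m, σ ^ i := by
  induction k with
  | zero => rw [pow_zero, one_mul]
  | succ k ih => rw [pow_succ, mul_assoc, mul_trace_eq hσ, ih]

/-- `(Σ_{j<k} σ^j) · Tr = k · Tr` when `σ^m = 1`. [cite: GrossLMS1991, §3 (3.5)] -/
theorem geom_sum_mul_trace_eq {σ : R} {m : ℕ} (hσ : σ ^ m = 1) (k : ℕ) :
    (∑ j ∈ range k, σ ^ j) * ∑ i ∈ range m, σ ^ i = (k : R) * ∑ i ∈ range m, σ ^ i := by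
  induction k with
  | zero => simp
  | succ k ih => rw [sum_range_succ, add_mul, ih, pow_mul_trace_eq hσ]; push_cast; ring

/-- Shift of the trace-like sum: `σ · Σ_{i<n} σ^{i+1} = Σ_{i<n} σ^{i+1} − σ + σ^{n+1}` (no hypothesis on `σ`). [folklore] -/
theorem mul_sum_pow_succ (σ : R) (n : ℕ) :
    σ * ∑ i ∈ range n, σ ^ (i + 1) = (∑ i ∈ range n, σ ^ (i + 1)) - σ + σ ^ (n + 1) := by
  induction n with
  | zero => simp
  | succ n ih => rw [sum_range_succ, mul_add, ih]; ring

/-- Shift of the derivative-like sum: `σ · Σ_{i<n} (i+1) σ^{i+1} = Σ_{i<n} (i+1) σ^{i+1} − Σ_{i<n} σ^{i+1} + n σ^{n+1}`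
(no hypothesis on `σ`). [folklore] -/
theorem mul_sum_natCast_succ_mul_pow_succ (σ : R) (n : ℕ) :
    σ * ∑ i ∈ range n, ((i : R) + 1) * σ ^ (i + 1) =
      (∑ i ∈ range n, ((i : R) + 1) * σ ^ (i + 1)) - (∑ i ∈ range n, σ ^ (i + 1)) + (n : R) * σ ^ (n + 1) := by
  induction n with
  | zero => simp
  | succ n ih => rw [sum_range_succ, sum_range_succ, mul_add, ih]; push_cast; ring

/-- `Σ_{i<m} σ^{i+1} = Tr` when `σ^m = 1` (the shifted trace is the trace). [cite: GrossLMS1991, §3 (3.5)] -/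
theorem sum_pow_succ_eq_trace {σ : R} {m : ℕ} (hσ : σ ^ m = 1) :
    ∑ i ∈ range m, σ ^ (i + 1) = ∑ i ∈ range m, σ ^ i := by
  cases m with
  | zero => simp
  | succ m => rw [sum_range_succ, sum_range_succ' (fun i ↦ σ ^ i), hσ, pow_zero]

/-- `Σ_{i<m} (i+1) σ^{i+1} = D + m` when `σ^m = 1` (the shifted derivative is `D + m σ^m = D + m`). [cite: GrossLMS1991, §3 (3.5)] -/
theorem sum_natCast_succ_mul_pow_succ_eq {σ : R} {m : ℕ} (hσ : σ ^ m = 1) :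
    ∑ i ∈ range m, ((i : R) + 1) * σ ^ (i + 1) = (∑ i ∈ range m, (i : R) * σ ^ i) + (m : R) := by
  cases m with
  | zero => simp
  | succ m =>
    rw [sum_range_succ (fun i ↦ ((i : R) + 1) * σ ^ (i + 1)),
      sum_range_succ' (fun i ↦ (i : R) * σ ^ i), hσ]
    push_cast
    ring

/-- **Gross (3.5) in the form `σ · D = D + (m − Tr)`** for `D = Σ_{i<m} i σ^i`, `Tr = Σ_{i<m} σ^i`, `σ^m = 1` — the tree's
`KolyvaginDerivative.sub_one_mul_kolyvaginDerivative` (`(σ − 1) D = m − Tr`), re-derived from the shift identities.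
[cite: GrossLMS1991, §3 (3.5)] -/
theorem mul_kolyvaginDerivative_eq {σ : R} {m : ℕ} (hσ : σ ^ m = 1) :
    σ * ∑ i ∈ range m, (i : R) * σ ^ i =
      (∑ i ∈ range m, (i : R) * σ ^ i) + ((m : R) - ∑ i ∈ range m, σ ^ i) := by
  have hB := mul_sum_natCast_succ_mul_pow_succ σ m
  rw [sum_natCast_succ_mul_pow_succ_eq hσ, sum_pow_succ_eq_trace hσ, pow_succ, hσ, one_mul, mul_add] at hB
  -- `hB : σ D + σ m = D + m − Tr + m σ`
  have : σ * ∑ i ∈ range m, (i : R) * σ ^ i =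
      (σ * ∑ i ∈ range m, (i : R) * σ ^ i + σ * (m : R)) - σ * (m : R) := by ring
  rw [this, hB]
  ring

/-- `σ^k · D = D + (Σ_{j<k} σ^j)(m − Tr)` when `σ^m = 1` (iterate `σ D = D + (m − Tr)`). [cite: GrossLMS1991, §3 (3.5)] -/
theorem pow_mul_kolyvaginDerivative_eq {σ : R} {m : ℕ} (hσ : σ ^ m = 1) (k : ℕ) :
    σ ^ k * ∑ i ∈ range m, (i : R) * σ ^ i =
      (∑ i ∈ range m, (i : R) * σ ^ i) + (∑ j ∈ range k, σ ^ j) * ((m : R) - ∑ i ∈ range m, σ ^ i) := by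
  induction k with
  | zero => simp
  | succ k ih =>
    rw [pow_succ, mul_assoc, mul_kolyvaginDerivative_eq hσ, mul_add, ih, sum_range_succ]
    ring

/-- **The reflection identity, `σ^m`-free form**: if `σ σ′ = 1` then for every `n`,
`σ^n · Σ_{i<n} i σ′^i = n · Σ_{i<n} σ^{i+1} − Σ_{i<n} (i+1) σ^{i+1}` (substitute `σ′^i = σ^{n−i}` and reindex; proved by
induction on `n`). [folklore] -/
theorem pow_mul_sum_natCast_mul_inv_pow {σ σ' : R} (hσσ' : σ * σ' = 1) (n : ℕ) :
    σ ^ n * ∑ i ∈ range n, (i : R) * σ' ^ i =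
      (n : R) * (∑ i ∈ range n, σ ^ (i + 1)) - ∑ i ∈ range n, ((i : R) + 1) * σ ^ (i + 1) := by
  induction n with
  | zero => simp
  | succ n ih =>
    have hinv : σ ^ (n + 1) * σ' ^ n = σ := by
      rw [pow_succ', mul_assoc, ← mul_pow, hσσ', one_pow, mul_one]
    have hA := mul_sum_pow_succ σ n
    have hB := mul_sum_natCast_succ_mul_pow_succ σ n
    rw [sum_range_succ, mul_add, show σ ^ (n + 1) * ∑ i ∈ range n, (i : R) * σ' ^ i =
        σ * (σ ^ n * ∑ i ∈ range n, (i : R) * σ' ^ i) by rw [pow_succ']; ring, ih,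
      show σ ^ (n + 1) * ((n : R) * σ' ^ n) = (n : R) * (σ ^ (n + 1) * σ' ^ n) by ring, hinv,
      sum_range_succ, sum_range_succ, mul_sub, show σ * ((n : R) * ∑ i ∈ range n, σ ^ (i + 1)) =
        (n : R) * (σ * ∑ i ∈ range n, σ ^ (i + 1)) by ring, hA, hB]
    push_cast
    ring

/-- **The reflection identity**: if `σ σ′ = 1` and `σ^m = 1` (so `σ′ = σ⁻¹` and `σ′^i = σ^{m−i}`) then
`Σ_{i<m} i σ′^i = m (Tr − 1) − D`, i.e. `τ D_ℓ τ⁻¹ = (ℓ+1)(Tr_ℓ − 1) − D_ℓ` for the conjugate derivative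
(Gross 1991, proof of Prop. 5.3 / McCallum §5: `τ D_ℓ = −D_ℓ τ` modulo `ℓ + 1`). [cite: GrossLMS1991, Prop. 5.3 (proof)] -/
theorem sum_natCast_mul_inv_pow_eq {σ σ' : R} {m : ℕ} (hσσ' : σ * σ' = 1) (hσ : σ ^ m = 1) :
    ∑ i ∈ range m, (i : R) * σ' ^ i =
      (m : R) * ((∑ i ∈ range m, σ ^ i) - 1) - ∑ i ∈ range m, (i : R) * σ ^ i := by
  have h := pow_mul_sum_natCast_mul_inv_pow hσσ' m
  rw [hσ, one_mul] at h
  rw [h]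
  rw [sum_pow_succ_eq_trace hσ, sum_natCast_succ_mul_pow_succ_eq hσ]
  ring

end Ring

/-! ## §2 The dihedral identity: the norm of the derivative at a complex conjugation -/

section Module

variable {R : Type*} [CommRing R] {M : Type*} [AddCommGroup M] [Module R M]

/-- `τ (σ^i • x) = σ′^i • τ x` from `τ (σ • x) = σ′ • τ x` (`τ σ = σ⁻¹ τ`: the generalized dihedral relation of
`Gal(K_n/ℚ) = Gal(K_n/K) ⋊ ⟨τ⟩`). [cite: GrossLMS1991, §5 (before Prop. 5.3)] -/
theorem map_pow_smul {σ σ' : R} (τ : M →+ M) (hτ : ∀ x : M, τ (σ • x) = σ' • τ x) (i : ℕ) (x : M) :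
    τ (σ ^ i • x) = σ' ^ i • τ x := by
  induction i with
  | zero => rw [pow_zero, pow_zero, one_smul, one_smul]
  | succ i ih => rw [pow_succ', mul_smul, hτ, ih, ← mul_smul, ← pow_succ']

/-- `τ ((r : R) • x) = r • τ x` for a natural-number scalar (additivity of `τ`). [folklore] -/
theorem map_natCast_smul (τ : M →+ M) (r : ℕ) (x : M) : τ ((r : R) • x) = (r : R) • τ x := by
  rw [Nat.cast_smul_eq_nsmul, Nat.cast_smul_eq_nsmul, map_nsmul]

/-- `τ (D • y) = (σ^{k₀} (m (Tr − 1) − D)) • y` — the conjugate of the derived point, from `τ y = σ^{k₀} • y`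
(`τ y_n = σ₀ y_n`, Gross Prop. 5.3 with `Φ(0) = 0`) and the reflection identity of §1. [cite: GrossLMS1991, Prop. 5.3 (proof)] -/
theorem map_kolyvaginDerivative_smul {σ σ' : R} {m k₀ : ℕ} (hσσ' : σ * σ' = 1) (hσ : σ ^ m = 1)
    (τ : M →+ M) (hτ : ∀ x : M, τ (σ • x) = σ' • τ x) {y : M} (hy : τ y = σ ^ k₀ • y) :
    τ ((∑ i ∈ range m, (i : R) * σ ^ i) • y) =
      (σ ^ k₀ * ((m : R) * ((∑ i ∈ range m, σ ^ i) - 1) - ∑ i ∈ range m, (i : R) * σ ^ i)) • y := by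
  rw [sum_smul, map_sum]
  simp_rw [mul_smul, map_natCast_smul, map_pow_smul τ hτ, hy]
  rw [← sum_natCast_mul_inv_pow_eq hσσ' hσ, sum_smul, smul_sum]
  refine sum_congr rfl fun i _ ↦ ?_
  simp only [← mul_smul]
  congr 1
  ring

/-- **THE DIHEDRAL IDENTITY (the norm of the Kolyvagin derivative at a complex conjugation).**  Let `R` be a
commutative ring (`ℤ[G_ℓ]`) acting on `M` (`E(K_ℓ)`), `σ, σ′ ∈ R` with `σ σ′ = 1`, `σ^m = 1` (`m = ℓ + 1`), `τ : M → M`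
additive with `τ (σ • x) = σ′ • τ x` (`τ σ τ = σ⁻¹`), and `y ∈ M` with `τ y = σ^{k₀} • y` (`τ y_ℓ = σ₀ y_ℓ`).  Then with
`D = Σ_{i<m} i σ^i`, `Tr = Σ_{i<m} σ^i`:
`D • y + τ (D • y) = −(m • Σ_{j<k₀+1} σ^j • y) + (m + k₀) • Tr • y`.
In particular `P_ℓ + τ P_ℓ ∈ 2^M E(K_ℓ)` EXPLICITLY when `2^M ∣ ℓ+1` and `2^M ∣ a_ℓ` (`Tr_ℓ y_ℓ = a_ℓ y_K`): the sign
`ε_ℓ = −1` of Gross Prop. 5.4 at one prime, with the quotient exhibited. [cite: GrossLMS1991, Prop. 5.3 and §3 (3.5)]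
[cite: McCallumLMS1991, §5] -/
theorem norm_kolyvaginDerivative_smul {σ σ' : R} {m k₀ : ℕ} (hσσ' : σ * σ' = 1) (hσ : σ ^ m = 1)
    (τ : M →+ M) (hτ : ∀ x : M, τ (σ • x) = σ' • τ x) {y : M} (hy : τ y = σ ^ k₀ • y) :
    (∑ i ∈ range m, (i : R) * σ ^ i) • y + τ ((∑ i ∈ range m, (i : R) * σ ^ i) • y) =
      -((m : R) • ∑ j ∈ range (k₀ + 1), σ ^ j • y) + ((m + k₀ : ℕ) : R) • (∑ i ∈ range m, σ ^ i) • y := by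
  rw [map_kolyvaginDerivative_smul hσσ' hσ τ hτ hy, ← add_smul]
  -- everything is now a ring identity in `R`, applied to `y`
  have hT := pow_mul_trace_eq hσ k₀
  have hD := pow_mul_kolyvaginDerivative_eq hσ k₀
  have hG := geom_sum_mul_trace_eq hσ k₀
  have key : (∑ i ∈ range m, (i : R) * σ ^ i) +
      σ ^ k₀ * ((m : R) * ((∑ i ∈ range m, σ ^ i) - 1) - ∑ i ∈ range m, (i : R) * σ ^ i) =
      -((m : R) * ∑ j ∈ range (k₀ + 1), σ ^ j) + ((m + k₀ : ℕ) : R) * ∑ i ∈ range m, σ ^ i := by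
    have e1 : σ ^ k₀ * ((m : R) * ((∑ i ∈ range m, σ ^ i) - 1) - ∑ i ∈ range m, (i : R) * σ ^ i) =
        (m : R) * (σ ^ k₀ * ∑ i ∈ range m, σ ^ i) - (m : R) * σ ^ k₀ -
          σ ^ k₀ * ∑ i ∈ range m, (i : R) * σ ^ i := by ring
    rw [e1, hT, hD, sum_range_succ]
    have e2 : (∑ j ∈ range k₀, σ ^ j) * ((m : R) - ∑ i ∈ range m, σ ^ i) =
        (m : R) * (∑ j ∈ range k₀, σ ^ j) - (∑ j ∈ range k₀, σ ^ j) * ∑ i ∈ range m, σ ^ i := by ring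
    rw [e2, hG]
    push_cast
    ring
  rw [key, add_smul, neg_smul, mul_smul, sum_smul, mul_smul]

end Module

/-! ## §3 The pairing into norms and the explicit root -/

section Pairing

variable {R : Type*} [CommRing R] {M : Type*} [AddCommGroup M] [Module R M]

/-- `τ (σ^j • y) = σ^{k₀ − j} • y` for `j ≤ k₀`: `τ` REVERSES the interval `σ^0 y, …, σ^{k₀} y`
(`σ′^j σ^{k₀} = σ^{k₀−j}` as `σ σ′ = 1`). [cite: GrossLMS1991, Prop. 5.3 (proof)] -/
theorem map_pow_smul_of_le {σ σ' : R} {k₀ : ℕ} (hσσ' : σ * σ' = 1) (τ : M →+ M)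
    (hτ : ∀ x : M, τ (σ • x) = σ' • τ x) {y : M} (hy : τ y = σ ^ k₀ • y) {j : ℕ} (hj : j ≤ k₀) :
    τ (σ ^ j • y) = σ ^ (k₀ - j) • y := by
  rw [map_pow_smul τ hτ, hy, ← mul_smul]
  congr 1
  obtain ⟨d, rfl⟩ := Nat.exists_eq_add_of_le hj
  rw [Nat.add_sub_cancel_left, pow_add, ← mul_assoc, mul_comm (σ' ^ j), ← mul_pow, hσσ', one_pow, one_mul]

/-- **The pairing, odd case `k₀ = 2h + 1`**: `Σ_{j<2h+2} σ^j • y = Y + τ Y` with `Y = Σ_{j<h+1} σ^j • y` — the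
interval splits into the `h + 1` norm pairs `{σ^j y, σ^{k₀−j} y}`. [cite: GrossLMS1991, Prop. 5.3 (proof)] -/
theorem sum_pow_smul_eq_norm_of_odd {σ σ' : R} {h : ℕ} (hσσ' : σ * σ' = 1) (τ : M →+ M)
    (hτ : ∀ x : M, τ (σ • x) = σ' • τ x) {y : M} (hy : τ y = σ ^ (2 * h + 1) • y) :
    ∑ j ∈ range (2 * h + 2), σ ^ j • y =
      (∑ j ∈ range (h + 1), σ ^ j • y) + τ (∑ j ∈ range (h + 1), σ ^ j • y) := by
  rw [map_sum, show 2 * h + 2 = (h + 1) + (h + 1) by ring, sum_range_add]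
  congr 1
  conv_rhs => rw [← sum_range_reflect]
  refine sum_congr rfl fun j hj ↦ ?_
  rw [mem_range] at hj
  rw [map_pow_smul_of_le hσσ' τ hτ hy (by omega)]
  congr 2
  omega

/-- **The pairing, even case `k₀ = 2h`**: `Σ_{j<2h+1} σ^j • y = (Y + τ Y) + σ^h • y` with `Y = Σ_{j<h} σ^j • y` —
`h` norm pairs and the MIDDLE term `σ^h y` (`(σ^h)² = σ^{k₀} = σ₀`: a square root of `σ₀`).
[cite: GrossLMS1991, Prop. 5.3 (proof)] -/
theorem sum_pow_smul_eq_norm_add_of_even {σ σ' : R} {h : ℕ} (hσσ' : σ * σ' = 1) (τ : M →+ M)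
    (hτ : ∀ x : M, τ (σ • x) = σ' • τ x) {y : M} (hy : τ y = σ ^ (2 * h) • y) :
    ∑ j ∈ range (2 * h + 1), σ ^ j • y =
      (∑ j ∈ range h, σ ^ j • y) + τ (∑ j ∈ range h, σ ^ j • y) + σ ^ h • y := by
  rw [map_sum, show 2 * h + 1 = h + (h + 1) by ring, sum_range_add,
    sum_range_succ' (fun k ↦ σ ^ (h + k) • y), add_zero, ← add_assoc]
  congr 2
  conv_rhs => rw [← sum_range_reflect]
  refine sum_congr rfl fun j hj ↦ ?_
  rw [mem_range] at hj
  rw [map_pow_smul_of_le hσσ' τ hτ hy (by omega)]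
  congr 2
  omega

/-- The middle term is `τ`-FIXED: `τ (σ^h • y) = σ^h • y` when `τ y = σ^{2h} • y` — `σ^h y_ℓ` is a τ-REAL Heegner value
(`Φ` of a CM point `x*` with `x̄* = w_N x*`). [cite: GrossLMS1991, Prop. 5.3] -/
theorem map_pow_half_smul_eq {σ σ' : R} {h : ℕ} (hσσ' : σ * σ' = 1) (τ : M →+ M)
    (hτ : ∀ x : M, τ (σ • x) = σ' • τ x) {y : M} (hy : τ y = σ ^ (2 * h) • y) :
    τ (σ ^ h • y) = σ ^ h • y := by
  rw [map_pow_smul_of_le hσσ' τ hτ hy (by omega)]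
  congr 2
  omega

/-- **Explicit norm, odd `k₀ = 2h+1`**: `D•y + τ(D•y) = −m • (Y + τ Y) + (m + k₀) • Tr • y`, `Y = Σ_{j ≤ h} σ^j • y`.
[cite: GrossLMS1991, Prop. 5.3 and §3 (3.5)] [cite: McCallumLMS1991, §5] -/
theorem norm_kolyvaginDerivative_smul_of_odd {σ σ' : R} {m h : ℕ} (hσσ' : σ * σ' = 1) (hσ : σ ^ m = 1)
    (τ : M →+ M) (hτ : ∀ x : M, τ (σ • x) = σ' • τ x) {y : M} (hy : τ y = σ ^ (2 * h + 1) • y) :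
    (∑ i ∈ range m, (i : R) * σ ^ i) • y + τ ((∑ i ∈ range m, (i : R) * σ ^ i) • y) =
      -((m : R) • ((∑ j ∈ range (h + 1), σ ^ j • y) + τ (∑ j ∈ range (h + 1), σ ^ j • y))) +
        ((m + (2 * h + 1) : ℕ) : R) • (∑ i ∈ range m, σ ^ i) • y := by
  rw [norm_kolyvaginDerivative_smul hσσ' hσ τ hτ hy, sum_pow_smul_eq_norm_of_odd hσσ' τ hτ hy]

/-- **Explicit norm, even `k₀ = 2h`**: `D•y + τ(D•y) = −m • (Y + τ Y) − m • σ^h • y + (m + k₀) • Tr • y`,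
`Y = Σ_{j<h} σ^j • y`, the middle term `σ^h • y` being `τ`-fixed (`map_pow_half_smul_eq`).
[cite: GrossLMS1991, Prop. 5.3 and §3 (3.5)] [cite: McCallumLMS1991, §5] -/
theorem norm_kolyvaginDerivative_smul_of_even {σ σ' : R} {m h : ℕ} (hσσ' : σ * σ' = 1) (hσ : σ ^ m = 1)
    (τ : M →+ M) (hτ : ∀ x : M, τ (σ • x) = σ' • τ x) {y : M} (hy : τ y = σ ^ (2 * h) • y) :
    (∑ i ∈ range m, (i : R) * σ ^ i) • y + τ ((∑ i ∈ range m, (i : R) * σ ^ i) • y) =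
      -((m : R) • ((∑ j ∈ range h, σ ^ j • y) + τ (∑ j ∈ range h, σ ^ j • y))) - (m : R) • σ ^ h • y +
        ((m + 2 * h : ℕ) : R) • (∑ i ∈ range m, σ ^ i) • y := by
  rw [norm_kolyvaginDerivative_smul hσσ' hσ τ hτ hy, sum_pow_smul_eq_norm_add_of_even hσσ' τ hτ hy, smul_add,
    neg_add, sub_eq_add_neg]

/-- **The `2^e`-th root exhibited, odd `k₀ = 2h+1`.**  If moreover `m = 2^e u` (`2^M ∣ ℓ + 1`) and `Tr • y = 2^e • t`
(`Tr_ℓ y_ℓ = a_ℓ y_K`, `2^M ∣ a_ℓ`), then `D•y + τ(D•y) = 2^e • (−(u • (Y + τ Y)) + (m + k₀) • t)`: the root of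
`P_ℓ + τ P_ℓ` is a NORM `−u · N_τ(Y)` plus a multiple of `t` (for `h_K = 1`: of `y_K`).  When `E(K_ℓ)` has no `2`-torsion
this IS the unique root `R` of memo §1. [cite: McCallumLMS1991, §5] [cite: GrossLMS1991, Prop. 5.3] -/
theorem norm_kolyvaginDerivative_smul_eq_two_pow_smul_of_odd {σ σ' : R} {m h e u : ℕ} (hσσ' : σ * σ' = 1)
    (hσ : σ ^ m = 1) (hm : m = 2 ^ e * u) (τ : M →+ M) (hτ : ∀ x : M, τ (σ • x) = σ' • τ x) {y t : M}
    (hy : τ y = σ ^ (2 * h + 1) • y) (ht : (∑ i ∈ range m, σ ^ i) • y = ((2 ^ e : ℕ) : R) • t) :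
    (∑ i ∈ range m, (i : R) * σ ^ i) • y + τ ((∑ i ∈ range m, (i : R) * σ ^ i) • y) =
      ((2 ^ e : ℕ) : R) • (-((u : R) • ((∑ j ∈ range (h + 1), σ ^ j • y) + τ (∑ j ∈ range (h + 1), σ ^ j • y))) +
        ((m + (2 * h + 1) : ℕ) : R) • t) := by
  rw [norm_kolyvaginDerivative_smul_of_odd hσσ' hσ τ hτ hy, ht]
  subst hm
  push_cast
  module

/-- **The `2^e`-th root exhibited, even `k₀ = 2h`.**  With `m = 2^e u` and `Tr • y = 2^e • t`:
`D•y + τ(D•y) = 2^e • (−(u • (Y + τ Y)) − u • σ^h • y + (m + k₀) • t)` — the root is a norm, plus `−u` times the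
τ-REAL middle value `σ^h y` (present iff `σ₀ = σ^{k₀}` is a square), plus a multiple of `t`.  In `Ĥ⁰(⟨τ⟩, ·)` its class
is `[u odd]·[σ^h y] + [(m+k₀)·(coefficient of t) odd]·[t]` (memo §2). [cite: McCallumLMS1991, §5] [cite: GrossLMS1991, Prop. 5.3] -/
theorem norm_kolyvaginDerivative_smul_eq_two_pow_smul_of_even {σ σ' : R} {m h e u : ℕ} (hσσ' : σ * σ' = 1)
    (hσ : σ ^ m = 1) (hm : m = 2 ^ e * u) (τ : M →+ M) (hτ : ∀ x : M, τ (σ • x) = σ' • τ x) {y t : M}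
    (hy : τ y = σ ^ (2 * h) • y) (ht : (∑ i ∈ range m, σ ^ i) • y = ((2 ^ e : ℕ) : R) • t) :
    (∑ i ∈ range m, (i : R) * σ ^ i) • y + τ ((∑ i ∈ range m, (i : R) * σ ^ i) • y) =
      ((2 ^ e : ℕ) : R) • (-((u : R) • ((∑ j ∈ range h, σ ^ j • y) + τ (∑ j ∈ range h, σ ^ j • y))) -
        (u : R) • σ ^ h • y + ((m + 2 * h : ℕ) : R) • t) := by
  rw [norm_kolyvaginDerivative_smul_of_even hσσ' hσ τ hτ hy, ht]
  subst hm
  push_cast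
  module

/-- **Norm form of the root (even case)**: under the hypotheses of `norm_kolyvaginDerivative_smul_eq_two_pow_smul_of_even`,
if `R₀` is ANY element with `2^e • R₀ = D•y + τ(D•y)` and `M` has no `2^e`-torsion (`2^e • x = 0 → x = 0`; e.g. `E(K_ℓ)[2] = 0`),
then `R₀ + u • σ^h • y − (m + k₀) • t = Z + τ Z` with `Z = −(u • Y)` — the root is a τ-NORM up to the middle value and `t`.
(So its class in `E(F)/N_τ E(K_ℓ)` is `[u • σ^h y] − [(m+k₀) • t]`, and its real component — the boundary-level archimedean
Selmer bit, memo §1 — is `[u odd]·λ(σ^h y_ℓ) + [((m+k₀)·a_ℓ/2^e) odd]·λ(y_K)`.) [cite: McCallumLMS1991, §5] -/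
theorem root_sub_eq_norm_of_even {σ σ' : R} {m h e u : ℕ} (hσσ' : σ * σ' = 1)
    (hσ : σ ^ m = 1) (hm : m = 2 ^ e * u) (τ : M →+ M) (hτ : ∀ x : M, τ (σ • x) = σ' • τ x) {y t R₀ : M}
    (hy : τ y = σ ^ (2 * h) • y) (ht : (∑ i ∈ range m, σ ^ i) • y = ((2 ^ e : ℕ) : R) • t)
    (h2 : ∀ x : M, ((2 ^ e : ℕ) : R) • x = 0 → x = 0)
    (hR₀ : ((2 ^ e : ℕ) : R) • R₀ =
      (∑ i ∈ range m, (i : R) * σ ^ i) • y + τ ((∑ i ∈ range m, (i : R) * σ ^ i) • y)) :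
    R₀ + (u : R) • σ ^ h • y - ((m + 2 * h : ℕ) : R) • t =
      -((u : R) • ∑ j ∈ range h, σ ^ j • y) + τ (-((u : R) • ∑ j ∈ range h, σ ^ j • y)) := by
  rw [norm_kolyvaginDerivative_smul_eq_two_pow_smul_of_even hσσ' hσ hm τ hτ hy ht] at hR₀
  have hR : R₀ = -((u : R) • ((∑ j ∈ range h, σ ^ j • y) + τ (∑ j ∈ range h, σ ^ j • y))) -
      (u : R) • σ ^ h • y + ((m + 2 * h : ℕ) : R) • t := by
    have := h2 (R₀ - (-((u : R) • ((∑ j ∈ range h, σ ^ j • y) + τ (∑ j ∈ range h, σ ^ j • y))) -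
      (u : R) • σ ^ h • y + ((m + 2 * h : ℕ) : R) • t)) (by rw [smul_sub, hR₀, sub_self])
    exact sub_eq_zero.mp this
  rw [hR, map_neg, map_natCast_smul τ u]
  module

/-- **Norm form of the root (odd case)**: with `2^e • R₀ = D•y + τ(D•y)` and no `2^e`-torsion,
`R₀ − (m + k₀) • t = Z + τ Z`, `Z = −(u • Y)`: for `σ₀` a NON-square the root is a τ-norm up to a multiple of `t` — its
class in `E(F)/N_τ E(K_ℓ)` is `[(m+k₀) • t]`, zero when `t ∈ 2 E(ℚ)` (memo §3: the boundary-level Selmer bit VANISHES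
for `(N/ℓ) = −1`, `M₀ ≥ 1`). [cite: McCallumLMS1991, §5] -/
theorem root_sub_eq_norm_of_odd {σ σ' : R} {m h e u : ℕ} (hσσ' : σ * σ' = 1)
    (hσ : σ ^ m = 1) (hm : m = 2 ^ e * u) (τ : M →+ M) (hτ : ∀ x : M, τ (σ • x) = σ' • τ x) {y t R₀ : M}
    (hy : τ y = σ ^ (2 * h + 1) • y) (ht : (∑ i ∈ range m, σ ^ i) • y = ((2 ^ e : ℕ) : R) • t)
    (h2 : ∀ x : M, ((2 ^ e : ℕ) : R) • x = 0 → x = 0)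
    (hR₀ : ((2 ^ e : ℕ) : R) • R₀ =
      (∑ i ∈ range m, (i : R) * σ ^ i) • y + τ ((∑ i ∈ range m, (i : R) * σ ^ i) • y)) :
    R₀ - ((m + (2 * h + 1) : ℕ) : R) • t =
      -((u : R) • ∑ j ∈ range (h + 1), σ ^ j • y) + τ (-((u : R) • ∑ j ∈ range (h + 1), σ ^ j • y)) := by
  rw [norm_kolyvaginDerivative_smul_eq_two_pow_smul_of_odd hσσ' hσ hm τ hτ hy ht] at hR₀
  have hR : R₀ = -((u : R) • ((∑ j ∈ range (h + 1), σ ^ j • y) + τ (∑ j ∈ range (h + 1), σ ^ j • y))) +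
      ((m + (2 * h + 1) : ℕ) : R) • t := by
    have := h2 (R₀ - (-((u : R) • ((∑ j ∈ range (h + 1), σ ^ j • y) + τ (∑ j ∈ range (h + 1), σ ^ j • y))) +
      ((m + (2 * h + 1) : ℕ) : R) • t)) (by rw [smul_sub, hR₀, sub_self])
    exact sub_eq_zero.mp this
  rw [hR, map_neg, map_natCast_smul τ u]
  module

end Pairing

end Summit.BirchSwinnertonDyer.BirchSwinnertonDyer.Theorems.OffBigImageOddLocalAtTwo.ArchBoundaryNorm
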